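import Mathlib
import Summits.ValiantsHypothesis.ValiantsHypothesis.Theorems.NewtonUnitEquationsDissociatedUniformTotalsLaw
import Summits.ValiantsHypothesis.ValiantsHypothesis.Theorems.NewtonUnitEquationsDissociatedUniformTotalsLawUnion
import Summits.ValiantsHypothesis.ValiantsHypothesis.Theorems.NewtonUnitEquationsDissociatedUniformTotalsLawChartTops
import Summits.ValiantsHypothesis.ValiantsHypothesis.Theorems.NewtonUnitEquationsDissociatedUniformTotalsLawChartLevels
import Summits.ValiantsHypothesis.ValiantsHypothesis.Theorems.NewtonUnitEquationsDissociatedUniformTotalsLawFibreDepthSets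
import Summits.ValiantsHypothesis.ValiantsHypothesis.Theorems.NewtonUnitEquationsDissociatedUniformTotalsLawDepthCells
import Literature.Computability.AlgebraicComplexity.NewtonPolygonTauProductBounds
import HarnessLib

/-!
# Crux `NewtonUnitEquations.DissociatedUniform` (stmt-ValiantsHypothesis-5905): the `n = 3` totals law — the AVERAGE UNION LAW (a random subfamily of fibres has `O(|G|)` hull vertices on average; `UnionTotalsLaw` holds ON AVERAGE over the position set)

The union-of-fibres sub-law of the `n = 3` totals law (`…TotalsLawUnion`: `UnionTotalsLaw C`, `∑_s #vert conv U_s(Z) ≤ C|G|²` for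
EVERY position set `Z`; OPEN, `C ≥ 2`; pointwise rung `UnionVertBound 3` OPEN; best unconditional bounds `O(|G|^{7/3})` /
`O(|G|^{4/3})` pointwise by Eisenbrand–Pach–Rothvoß–Sopher, `…TotalsLawUnionEPRS`) holds ON AVERAGE over `Z`, with a LINEAR pointwise
mean: for all `a b : G → ℝ²` (no injectivity, no general position)

  `∑_{R ⊆ G} #vert conv (⋃_{r ∈ R} P_r) ≤ 1584000 · |G| · 2^{|G|}`   (`sum_unionFibVert_le`),
  `∑_{Z ⊆ G} unionTotal a b Z ≤ 1584000 · |G|² · 2^{|G|}`            (`sum_unionTotal_le`: the mean of the union total over the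
                                                                       `2^{|G|}` position sets is `≤ 1584000·|G|²`).

PROOF (memo `Cruxes/DissociatedUniform/NOTES-t1g12.md` §2; first use of LEVELS OF THE FIBRE ARRANGEMENT here).  Along a half-chart
`σ = ±1`, a strict top `v` of `U_R = ⋃_{r∈R} P_r` at time `t` has its above-fibre set `aboveFib σ t v` (`…TotalsLawFibreDepthSets`) disjoint
from `R`; perturbing `t` off a finite exceptional set, `#{R : v is a chart top of U_R} ≤ ∑_F 2^{|G| - #F}` over the realised depth sets `F`
of `v`.  Summing over `v ∈ A + B` and grading by `j = #F`, the pairs of order `j` are depth pairs of order `≤ j` off the low-event times,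
at most `(32|G|(j+1)+1)(j+1)²((j+1)²+1) ≤ 66|G|(j+1)⁵` of them (`…TotalsLawDepthCells.card_depthPairs_le_poly`), and
`∑_j 2^{-j}(j+1)⁵ ≤ 12000` closes the count: `∑_R #tops_σ(U_R) ≤ 792000·|G|·2^{|G|}` per half-chart.  The constant is not optimised
(census: mean `#vert(U_R) ≈ 0.8–1.3 |G|`).  Also: `card_filter_unionTotal_gt_le` (Markov: the exceptional position sets are sparse).
Honest label: `UnionTotalsLaw C` (every `Z`), `UnionVertBound`, `TotalsLawThree` remain OPEN; nothing here bears on VP ≠ VNP.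
[folklore: Clarkson–Shor style double counting over subsets; levels in arrangements of lines]
-/

set_option linter.dupNamespace false -- `ValiantsHypothesis.ValiantsHypothesis` (summit = problem) in every name

open scoped BigOperators Pointwise
open Matrix Finset

namespace Summit.ValiantsHypothesis.ValiantsHypothesis.Theorems.NewtonUnitEquationsDissociatedUniform

namespace TotalsLaw

open Literature.Computability.AlgebraicComplexity.KPTT.PlanarMinkowski

section AverageUnion

variable {G : Type*} [AddCommGroup G] [Fintype G] [DecidableEq G]

open Classical in
/-- Finset model of the union of fibres `U_R = ⋃_{r ∈ R} P_r`. -/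
noncomputable def unionFib (a b : G → (Fin 2 → ℝ)) (R : Finset G) : Finset (Fin 2 → ℝ) := R.biUnion (fibFin a b)

open Classical in
/-- The chart tops of `U_R` along the half-chart `σ`: points that are the strict top of `U_R` at some weight `(σ, t)`. -/
noncomputable def topsAlong (a b : G → (Fin 2 → ℝ)) (σ : ℝ) (R : Finset G) : Finset (Fin 2 → ℝ) :=
  (unionFib a b R).filter fun v => ∃ t : ℝ, IsStrictTop ![σ, t] (unionFib a b R) v

open Classical in
/-- The depth sets of `v` realised at times off `T`: `{aboveFib σ t v : t ∉ T}`. -/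
noncomputable def depthSetsOff (a b : G → (Fin 2 → ℝ)) (σ : ℝ) (T : Finset ℝ) (v : Fin 2 → ℝ) : Finset (Finset G) :=
  (Finset.univ : Finset G).powerset.filter fun F => ∃ t : ℝ, t ∉ T ∧ F = aboveFib a b σ t v

omit [DecidableEq G] in
/-- Membership in the union of fibres. [folklore] -/
theorem mem_unionFib {a b : G → (Fin 2 → ℝ)} {R : Finset G} {w : Fin 2 → ℝ} :
    w ∈ unionFib a b R ↔ ∃ r ∈ R, w ∈ fibFin a b r := by
  classical
  unfold unionFib
  rw [Finset.mem_biUnion]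

omit [DecidableEq G] in
/-- `U_R ⊆ A + B`. [folklore] -/
theorem unionFib_subset_sumFin (a b : G → (Fin 2 → ℝ)) (R : Finset G) : unionFib a b R ⊆ sumFin a b := by
  intro w hw
  obtain ⟨r, -, hr⟩ := mem_unionFib.1 hw
  exact fibFin_subset_sumFin a b r hr

omit [DecidableEq G] in
/-- Chart tops are points of `A + B`. [folklore] -/
theorem topsAlong_subset_sumFin (a b : G → (Fin 2 → ℝ)) (σ : ℝ) (R : Finset G) : topsAlong a b σ R ⊆ sumFin a b := by
  classical
  intro v hv
  unfold topsAlong at hv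
  exact unionFib_subset_sumFin a b R (Finset.mem_filter.1 hv).1

omit [DecidableEq G] in
/-- **`#vert conv U_R ≤ #tops₊ + #tops₋`**: every hull vertex is a strict top along one of the two half-charts
(`mem_extremePoints_iff_charts`). [folklore] -/
theorem ncard_extremePoints_unionFib_le (a b : G → (Fin 2 → ℝ)) (R : Finset G) :
    ((convexHull ℝ (unionFib a b R : Set (Fin 2 → ℝ))).extremePoints ℝ).ncard ≤
      (topsAlong a b 1 R).card + (topsAlong a b (-1) R).card := by
  classical
  rw [extremePoints_eq_coe_filter_charts (unionFib a b R), Set.ncard_coe_finset, Finset.filter_or]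
  unfold topsAlong
  exact Finset.card_union_le _ _

omit [DecidableEq G] in
/-- **A strict top of `U_R` has no fibre of `R` above it.** [folklore] -/
theorem not_mem_aboveFib_of_isStrictTop {a b : G → (Fin 2 → ℝ)} {σ t : ℝ} {R : Finset G} {v : Fin 2 → ℝ}
    (hv : IsStrictTop ![σ, t] (unionFib a b R) v) {r : G} (hr : r ∈ R) : r ∉ aboveFib a b σ t v := by
  intro h
  obtain ⟨x, hx⟩ := mem_aboveFib.1 h
  have hw : a x + b (r - x) ∈ unionFib a b R := mem_unionFib.2 ⟨r, hr, mem_fibFin.2 ⟨x, rfl⟩⟩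
  exact absurd (hv.le hw) (not_le.2 hx)

omit [DecidableEq G] in
/-- A chart top is a strict top at some time OFF any given finite set of times (strict tops are stable under perturbation of the
chart parameter). [folklore] -/
theorem exists_isStrictTop_not_mem {a b : G → (Fin 2 → ℝ)} {σ : ℝ} {R : Finset G} {v : Fin 2 → ℝ}
    (hv : v ∈ topsAlong a b σ R) (T : Finset ℝ) : ∃ t : ℝ, t ∉ T ∧ IsStrictTop ![σ, t] (unionFib a b R) v := by
  classical
  unfold topsAlong at hv
  obtain ⟨-, t₀, ht₀⟩ := Finset.mem_filter.1 hv
  obtain ⟨ε, hε, hall⟩ := ht₀.exists_perturb_chart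
  have hinf : (Set.Icc (t₀ - ε) (t₀ + ε)).Infinite := Set.Icc_infinite (by linarith)
  obtain ⟨t, ht, htT⟩ := hinf.exists_notMem_finset T
  refine ⟨t, htT, hall t ?_⟩
  rw [Set.mem_Icc] at ht
  exact abs_le.2 ⟨by linarith, by linarith⟩

/-- **Certificate count.**  The subsets `R` for which `v` is a chart top number at most `∑_F 2^{|G| - #F}` over the depth sets
`F` of `v` realised off `T`: such an `R` misses the depth set of `v` at a witnessing time off `T`. [folklore] -/
theorem card_filter_mem_topsAlong_le (a b : G → (Fin 2 → ℝ)) (σ : ℝ) (T : Finset ℝ) (v : Fin 2 → ℝ) :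
    ((Finset.univ : Finset (Finset G)).filter fun R => v ∈ topsAlong a b σ R).card ≤
      ∑ F ∈ depthSetsOff a b σ T v, 2 ^ (Fintype.card G - F.card) := by
  classical
  have hsub : ((Finset.univ : Finset (Finset G)).filter fun R => v ∈ topsAlong a b σ R) ⊆
      (depthSetsOff a b σ T v).biUnion fun F => ((Finset.univ : Finset G) \ F).powerset := by
    intro R hR
    obtain ⟨-, hv⟩ := Finset.mem_filter.1 hR
    obtain ⟨t, htT, htop⟩ := exists_isStrictTop_not_mem hv T
    rw [Finset.mem_biUnion]
    refine ⟨aboveFib a b σ t v, ?_, ?_⟩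
    · unfold depthSetsOff
      exact Finset.mem_filter.2 ⟨Finset.mem_powerset.2 (Finset.subset_univ _), t, htT, rfl⟩
    · rw [Finset.mem_powerset]
      intro r hr
      exact Finset.mem_sdiff.2 ⟨Finset.mem_univ _, not_mem_aboveFib_of_isStrictTop htop hr⟩
  calc _ ≤ ((depthSetsOff a b σ T v).biUnion fun F => ((Finset.univ : Finset G) \ F).powerset).card := Finset.card_le_card hsub
    _ ≤ ∑ F ∈ depthSetsOff a b σ T v, (((Finset.univ : Finset G) \ F).powerset).card := Finset.card_biUnion_le
    _ = ∑ F ∈ depthSetsOff a b σ T v, 2 ^ (Fintype.card G - F.card) := by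
        refine Finset.sum_congr rfl fun F _ => ?_
        rw [Finset.card_powerset, Finset.card_sdiff_of_subset (Finset.subset_univ F), Finset.card_univ]

omit [DecidableEq G] in
/-- **Double counting**: `∑_R #tops_σ(U_R) = ∑_{v ∈ A+B} #{R : v ∈ tops_σ(U_R)}`. [folklore] -/
theorem sum_card_topsAlong_eq (a b : G → (Fin 2 → ℝ)) (σ : ℝ) :
    ∑ R : Finset G, (topsAlong a b σ R).card =
      ∑ v ∈ sumFin a b, ((Finset.univ : Finset (Finset G)).filter fun R => v ∈ topsAlong a b σ R).card := by
  classical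
  have h1 : ∀ R : Finset G, (topsAlong a b σ R).card = ∑ v ∈ sumFin a b, if v ∈ topsAlong a b σ R then 1 else 0 := by
    intro R
    rw [Finset.sum_boole, Finset.filter_mem_eq_inter, Finset.inter_eq_right.2 (topsAlong_subset_sumFin a b σ R)]
    simp
  have h2 : ∀ v : Fin 2 → ℝ, ((Finset.univ : Finset (Finset G)).filter fun R => v ∈ topsAlong a b σ R).card =
      ∑ R : Finset G, if v ∈ topsAlong a b σ R then 1 else 0 := by
    intro v
    rw [Finset.sum_boole]
    simp
  simp_rw [h1, h2]
  exact Finset.sum_comm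

omit [DecidableEq G] in
/-- **Grading by depth.**  `∑_{v ∈ A+B} ∑_{F ∈ depthSets(v)} 2^{|G| - #F} ≤ ∑_{j ≤ |G|} 2^{|G| - j} · #depthPairs_j(T)`: a realised depth
set of size `j` off `T` is a depth pair of order `≤ j` off `T`. [folklore] -/
theorem sum_sum_pow_le (a b : G → (Fin 2 → ℝ)) (σ : ℝ) (T : Finset ℝ) :
    ∑ v ∈ sumFin a b, ∑ F ∈ depthSetsOff a b σ T v, 2 ^ (Fintype.card G - F.card) ≤
      ∑ j ∈ Finset.range (Fintype.card G + 1), 2 ^ (Fintype.card G - j) * (depthPairs a b σ j T).card := by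
  classical
  set q := Fintype.card G with hq
  set S := (sumFin a b).sigma fun v => depthSetsOff a b σ T v with hS
  have hsig : ∑ v ∈ sumFin a b, ∑ F ∈ depthSetsOff a b σ T v, 2 ^ (q - F.card) = ∑ p ∈ S, 2 ^ (q - p.2.card) :=
    (Finset.sum_sigma (sumFin a b) (fun v => depthSetsOff a b σ T v) (fun p => 2 ^ (q - p.2.card))).symm
  rw [hsig]
  have hmaps : ∀ p ∈ S, (fun p : (Σ _ : Fin 2 → ℝ, Finset G) => p.2.card) p ∈ Finset.range (q + 1) := by
    intro p _
    exact Finset.mem_range.2 (Nat.lt_succ_of_le (by rw [hq, ← Finset.card_univ]; exact Finset.card_le_univ _))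
  rw [← Finset.sum_fiberwise_of_maps_to hmaps]
  refine Finset.sum_le_sum fun j _ => ?_
  have hconst : ∑ p ∈ S.filter (fun p => p.2.card = j), 2 ^ (q - p.2.card) =
      ∑ p ∈ S.filter (fun p => p.2.card = j), 2 ^ (q - j) := by
    refine Finset.sum_congr rfl fun p hp => ?_
    rw [(Finset.mem_filter.1 hp).2]
  rw [hconst, Finset.sum_const, smul_eq_mul, mul_comm]
  refine Nat.mul_le_mul_left _ ?_
  -- inject the graded pairs into `depthPairs`
  refine Finset.card_le_card_of_injOn (fun p => (p.1, p.2)) (fun p hp => ?_) ?_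
  · obtain ⟨hpS, hpj⟩ := Finset.mem_filter.1 hp
    rw [hS, Finset.mem_sigma] at hpS
    obtain ⟨hv, hF⟩ := hpS
    unfold depthSetsOff at hF
    obtain ⟨hFpow, t, htT, hFt⟩ := Finset.mem_filter.1 hF
    rw [Finset.mem_coe]
    unfold depthPairs
    exact Finset.mem_filter.2 ⟨Finset.mem_product.2 ⟨hv, hFpow⟩, t, htT, hFt, hpj.le⟩
  · intro p _ p' _ h
    obtain ⟨v, F⟩ := p
    obtain ⟨v', F'⟩ := p'
    simp only [Prod.mk.injEq] at h
    obtain ⟨rfl, rfl⟩ := h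
    rfl
/-! ### Numerics: `2^j (j+1)^5 ≤ 3000·3^j` and the level-weighted sum -/

/-- `2 (n+1)^5 ≤ 3 n^5` for `n ≥ 12` (since `(13/12)^5 < 3/2`). [folklore] -/
theorem two_mul_succ_pow_five_le {n : ℕ} (hn : 12 ≤ n) : 2 * (n + 1) ^ 5 ≤ 3 * n ^ 5 := by
  have h : 12 * (n + 1) ≤ 13 * n := by omega
  have h5 : (12 * (n + 1)) ^ 5 ≤ (13 * n) ^ 5 := Nat.pow_le_pow_left h 5
  rw [mul_pow, mul_pow] at h5
  norm_num at h5
  have key : 248832 * (2 * (n + 1) ^ 5) ≤ 248832 * (3 * n ^ 5) := by linarith [Nat.zero_le (n ^ 5)]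
  exact Nat.le_of_mul_le_mul_left key (by norm_num)

/-- `2^j · (j+1)^5 ≤ 3000 · 3^j` for every `j` (i.e. `(j+1)^5 ≤ 3000·(3/2)^j`). [folklore] -/
theorem two_pow_mul_pow_five_le (j : ℕ) : 2 ^ j * (j + 1) ^ 5 ≤ 3000 * 3 ^ j := by
  by_cases hj : j < 11
  · interval_cases j <;> norm_num
  · push Not at hj
    induction j, hj using Nat.le_induction with
    | base => norm_num
    | succ m hm ih =>
      have hstep : 2 * (m + 1 + 1) ^ 5 ≤ 3 * (m + 1) ^ 5 := two_mul_succ_pow_five_le (by omega)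
      calc 2 ^ (m + 1) * (m + 1 + 1) ^ 5 = 2 ^ m * (2 * (m + 1 + 1) ^ 5) := by ring
        _ ≤ 2 ^ m * (3 * (m + 1) ^ 5) := Nat.mul_le_mul_left _ hstep
        _ = 3 * (2 ^ m * (m + 1) ^ 5) := by ring
        _ ≤ 3 * (3000 * 3 ^ m) := Nat.mul_le_mul_left _ ih
        _ = 3000 * 3 ^ (m + 1) := by ring

/-- `∑_{j<N} (j+1)^5 / 2^j ≤ 12000` (real form: termwise `≤ 3000·(3/4)^j`, geometric sum `≤ 4`). [folklore] -/
theorem sum_pow_five_div_two_pow_le (N : ℕ) : ∑ j ∈ Finset.range N, ((j : ℝ) + 1) ^ 5 / 2 ^ j ≤ 12000 := by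
  have hterm : ∀ j : ℕ, ((j : ℝ) + 1) ^ 5 / 2 ^ j ≤ 3000 * (3 / 4 : ℝ) ^ j := by
    intro j
    have h := two_pow_mul_pow_five_le j
    have hcast : (2 : ℝ) ^ j * ((j : ℝ) + 1) ^ 5 ≤ 3000 * 3 ^ j := by exact_mod_cast h
    have h2 : (0 : ℝ) < 2 ^ j := by positivity
    rw [div_le_iff₀ h2, show (3 / 4 : ℝ) ^ j = 3 ^ j / (2 ^ j * 2 ^ j) by
      rw [← mul_pow, ← div_pow]; norm_num]
    rw [mul_div_assoc', div_mul_eq_mul_div, le_div_iff₀ (by positivity)]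
    nlinarith [h2]
  have hgeom : ∑ j ∈ Finset.range N, (3 / 4 : ℝ) ^ j ≤ 4 := by
    rw [geom_sum_eq (by norm_num) N]
    have h0 : (0 : ℝ) ≤ (3 / 4 : ℝ) ^ N := by positivity
    have : ((3 / 4 : ℝ) ^ N - 1) / ((3 / 4 : ℝ) - 1) = 4 * (1 - (3 / 4 : ℝ) ^ N) := by ring
    rw [this]
    nlinarith
  calc ∑ j ∈ Finset.range N, ((j : ℝ) + 1) ^ 5 / 2 ^ j ≤ ∑ j ∈ Finset.range N, 3000 * (3 / 4 : ℝ) ^ j :=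
        Finset.sum_le_sum fun j _ => hterm j
    _ = 3000 * ∑ j ∈ Finset.range N, (3 / 4 : ℝ) ^ j := by rw [Finset.mul_sum]
    _ ≤ 3000 * 4 := by nlinarith
    _ = 12000 := by norm_num

/-- `∑_{j ≤ q} 2^{q-j} (j+1)^5 ≤ 12000 · 2^q`. [folklore] -/
theorem sum_two_pow_sub_mul_pow_five_le (q : ℕ) :
    ∑ j ∈ Finset.range (q + 1), 2 ^ (q - j) * (j + 1) ^ 5 ≤ 12000 * 2 ^ q := by
  have hreal : ((∑ j ∈ Finset.range (q + 1), 2 ^ (q - j) * (j + 1) ^ 5 : ℕ) : ℝ) ≤ ((12000 * 2 ^ q : ℕ) : ℝ) := by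
    push_cast
    have hterm : ∀ j ∈ Finset.range (q + 1),
        (2 : ℝ) ^ (q - j) * ((j : ℝ) + 1) ^ 5 = 2 ^ q * (((j : ℝ) + 1) ^ 5 / 2 ^ j) := by
      intro j hj
      have hjq : j ≤ q := Nat.lt_succ_iff.1 (Finset.mem_range.1 hj)
      rw [pow_sub₀ (2 : ℝ) two_ne_zero hjq]
      field_simp
    rw [Finset.sum_congr rfl hterm, ← Finset.mul_sum]
    have h2q : (0 : ℝ) < 2 ^ q := by positivity
    nlinarith [sum_pow_five_div_two_pow_le (q + 1)]
  exact_mod_cast hreal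

/-- The depth-pair polynomial is at most `66|G|(j+1)^5` (for `|G| ≥ 1`). [folklore] -/
theorem depthPoly_le {q : ℕ} (hq : 1 ≤ q) (j : ℕ) :
    (32 * q * (j + 1) + 1) * ((j + 1) ^ 2 * ((j + 1) ^ 2 + 1)) ≤ 66 * q * (j + 1) ^ 5 := by
  have hm : 1 ≤ j + 1 := Nat.succ_le_succ (Nat.zero_le j)
  have h1 : 32 * q * (j + 1) + 1 ≤ 33 * q * (j + 1) := by nlinarith
  have hsq : 1 ≤ (j + 1) ^ 2 := Nat.one_le_pow _ _ hm
  have h2 : (j + 1) ^ 2 * ((j + 1) ^ 2 + 1) ≤ 2 * (j + 1) ^ 4 := by nlinarith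
  calc _ ≤ (33 * q * (j + 1)) * (2 * (j + 1) ^ 4) := Nat.mul_le_mul h1 h2
    _ = 66 * q * (j + 1) ^ 5 := by ring
/-! ### The average union law -/

/-- **Per half-chart: `∑_R #tops_σ(U_R) ≤ 792000 · |G| · 2^{|G|}`** (`σ ≠ 0`). [folklore] -/
theorem sum_card_topsAlong_le (a b : G → (Fin 2 → ℝ)) {σ : ℝ} (hσ : σ ≠ 0) :
    ∑ R : Finset G, (topsAlong a b σ R).card ≤ 792000 * Fintype.card G * 2 ^ Fintype.card G := by
  classical
  set q := Fintype.card G with hq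
  have hq1 : 1 ≤ q := Fintype.card_pos
  -- the exceptional times: all low-event times of order `≤ q` of both alphabets
  set T : Finset ℝ := (Finset.range (q + 1)).biUnion fun j => lowTimes a b σ j with hT
  have hTj : ∀ j ∈ Finset.range (q + 1), lowTimes a b σ j ⊆ T := fun j hj =>
    Finset.subset_biUnion_of_mem (fun j => lowTimes a b σ j) hj
  calc ∑ R : Finset G, (topsAlong a b σ R).card
      = ∑ v ∈ sumFin a b, ((Finset.univ : Finset (Finset G)).filter fun R => v ∈ topsAlong a b σ R).card :=
        sum_card_topsAlong_eq a b σ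
    _ ≤ ∑ v ∈ sumFin a b, ∑ F ∈ depthSetsOff a b σ T v, 2 ^ (q - F.card) :=
        Finset.sum_le_sum fun v _ => card_filter_mem_topsAlong_le a b σ T v
    _ ≤ ∑ j ∈ Finset.range (q + 1), 2 ^ (q - j) * (depthPairs a b σ j T).card := sum_sum_pow_le a b σ T
    _ ≤ ∑ j ∈ Finset.range (q + 1), 2 ^ (q - j) * (66 * q * (j + 1) ^ 5) :=
        Finset.sum_le_sum fun j hj => Nat.mul_le_mul_left _
          ((card_depthPairs_le_poly a b hσ j T (hTj j hj)).trans (depthPoly_le hq1 j))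
    _ = 66 * q * ∑ j ∈ Finset.range (q + 1), 2 ^ (q - j) * (j + 1) ^ 5 := by
        rw [Finset.mul_sum]
        exact Finset.sum_congr rfl fun j _ => by ring
    _ ≤ 66 * q * (12000 * 2 ^ q) := Nat.mul_le_mul_left _ (sum_two_pow_sub_mul_pow_five_le q)
    _ = 792000 * q * 2 ^ q := by ring

/-- **THE AVERAGE UNION LAW (hull form).**  Summed over all `2^{|G|}` subfamilies `R` of the fibres of `A + B`, the union hulls have at
most `1584000 · |G| · 2^{|G|}` vertices: a uniformly random subfamily has `≤ 1584000·|G|` hull vertices ON AVERAGE (EPRS gives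
`48|G|^{4/3}` for EVERY subfamily; `UnionVertBound 3` would give `3|G|`). [folklore] -/
theorem sum_unionFibVert_le (a b : G → (Fin 2 → ℝ)) :
    ∑ R : Finset G, ((convexHull ℝ (unionFib a b R : Set (Fin 2 → ℝ))).extremePoints ℝ).ncard ≤
      1584000 * Fintype.card G * 2 ^ Fintype.card G := by
  calc _ ≤ ∑ R : Finset G, ((topsAlong a b 1 R).card + (topsAlong a b (-1) R).card) :=
        Finset.sum_le_sum fun R _ => ncard_extremePoints_unionFib_le a b R
    _ = ∑ R : Finset G, (topsAlong a b 1 R).card + ∑ R : Finset G, (topsAlong a b (-1) R).card := Finset.sum_add_distrib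
    _ ≤ 792000 * Fintype.card G * 2 ^ Fintype.card G + 792000 * Fintype.card G * 2 ^ Fintype.card G :=
        add_le_add (sum_card_topsAlong_le a b one_ne_zero) (sum_card_topsAlong_le a b (by norm_num))
    _ = 1584000 * Fintype.card G * 2 ^ Fintype.card G := by ring

omit [DecidableEq G] in
/-- The carrier of a fibre finset is the fibre. [folklore] -/
theorem coe_fibFin (a b : G → (Fin 2 → ℝ)) (r : G) : (fibFin a b r : Set (Fin 2 → ℝ)) = fibrePts a b r := by
  unfold fibFin fibrePts
  rw [Finset.coe_image, Finset.coe_univ, Set.image_univ]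

/-- The union of fibres at the positions `Z` of class `s` is `U_R` with `R = s - Z`. [folklore] -/
theorem coe_unionFib_image (a b : G → (Fin 2 → ℝ)) (Z : Finset G) (s : G) :
    (unionFib a b (Z.image fun z => s - z) : Set (Fin 2 → ℝ)) = unionPts a b (Z : Set G) s := by
  classical
  ext p
  rw [Finset.mem_coe, mem_unionFib, mem_unionPts]
  constructor
  · rintro ⟨r, hr, hp⟩
    obtain ⟨z, hz, rfl⟩ := Finset.mem_image.1 hr
    obtain ⟨x, rfl⟩ := mem_fibFin.1 hp
    exact ⟨x, s - z - x, by rw [show s - x - (s - z - x) = z by abel]; exact Finset.mem_coe.2 hz, rfl⟩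
  · rintro ⟨x, y, hxy, rfl⟩
    refine ⟨x + y, Finset.mem_image.2 ⟨s - x - y, Finset.mem_coe.1 hxy, by abel⟩, mem_fibFin.2 ⟨x, ?_⟩⟩
    rw [show x + y - x = y by abel]

/-- `unionVert a b Z s` is the hull-vertex count of `U_{s - Z}`. [folklore] -/
theorem unionVert_eq_ncard_unionFib (a b : G → (Fin 2 → ℝ)) (Z : Finset G) (s : G) :
    unionVert a b (Z : Set G) s =
      ((convexHull ℝ (unionFib a b (Z.image fun z => s - z) : Set (Fin 2 → ℝ))).extremePoints ℝ).ncard := by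
  unfold unionVert
  rw [coe_unionFib_image]

/-- **THE AVERAGE UNION LAW (class form).**  For every class `s`: `∑_{Z ⊆ G} #vert conv U_s(Z) ≤ 1584000 · |G| · 2^{|G|}` (the map
`Z ↦ s - Z` permutes the position sets). [folklore] -/
theorem sum_unionVert_le (a b : G → (Fin 2 → ℝ)) (s : G) :
    ∑ Z : Finset G, unionVert a b (Z : Set G) s ≤ 1584000 * Fintype.card G * 2 ^ Fintype.card G := by
  classical
  simp_rw [unionVert_eq_ncard_unionFib]
  -- reindex by the permutation `Z ↦ s - Z` of `Finset G`
  set e : Finset G ≃ Finset G := (Equiv.subLeft s).finsetCongr with he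
  have hre : ∀ Z : Finset G, Z.image (fun z => s - z) = e Z := by
    intro Z
    rw [he, Equiv.finsetCongr_apply, Finset.map_eq_image]
    rfl
  simp_rw [hre]
  rw [Equiv.sum_comp e (fun R => ((convexHull ℝ (unionFib a b R : Set (Fin 2 → ℝ))).extremePoints ℝ).ncard)]
  exact sum_unionFibVert_le a b

/-- **THE AVERAGE UNION TOTALS LAW.**  `∑_{Z ⊆ G} unionTotal a b Z ≤ 1584000 · |G|² · 2^{|G|}`: the MEAN of the union total over
the `2^{|G|}` position sets is at most `1584000·|G|²` — `UnionTotalsLaw` holds on average over `Z`, for every `a b : G → ℝ²`.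
(`UnionTotalsLaw C` itself, i.e. EVERY `Z`, remains OPEN.) [folklore] -/
theorem sum_unionTotal_le (a b : G → (Fin 2 → ℝ)) :
    ∑ Z : Finset G, unionTotal a b (Z : Set G) ≤ 1584000 * Fintype.card G ^ 2 * 2 ^ Fintype.card G := by
  unfold unionTotal
  rw [Finset.sum_comm]
  calc ∑ s : G, ∑ Z : Finset G, unionVert a b (Z : Set G) s
      ≤ ∑ _s : G, 1584000 * Fintype.card G * 2 ^ Fintype.card G := Finset.sum_le_sum fun s _ => sum_unionVert_le a b s
    _ = 1584000 * Fintype.card G ^ 2 * 2 ^ Fintype.card G := by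
        rw [Finset.sum_const, Finset.card_univ, smul_eq_mul]; ring

/-- **Sparse exceptions (Markov).**  For every `λ`, the position sets `Z` with `unionTotal a b Z > λ·|G|²` are fewer than a
`1584000/λ` fraction of all `2^{|G|}` of them: `λ · #{Z : λ|G|² < unionTotal a b Z} ≤ 1584000 · 2^{|G|}`. [folklore] -/
theorem card_filter_unionTotal_gt_le (a b : G → (Fin 2 → ℝ)) (lam : ℕ) :
    lam * ((Finset.univ : Finset (Finset G)).filter fun Z : Finset G =>
        lam * Fintype.card G ^ 2 < unionTotal a b (↑Z : Set G)).card ≤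
      1584000 * 2 ^ Fintype.card G := by
  classical
  set q := Fintype.card G with hq
  have hq1 : 0 < q ^ 2 := pow_pos Fintype.card_pos 2
  set E := (Finset.univ : Finset (Finset G)).filter fun Z : Finset G => lam * q ^ 2 < unionTotal a b (↑Z : Set G) with hE
  have h1 : E.card * (lam * q ^ 2) ≤ ∑ Z ∈ E, unionTotal a b (Z : Set G) := by
    rw [← smul_eq_mul, ← Finset.sum_const]
    exact Finset.sum_le_sum fun Z hZ => (Finset.mem_filter.1 hZ).2.le
  have h2 : ∑ Z ∈ E, unionTotal a b (Z : Set G) ≤ ∑ Z : Finset G, unionTotal a b (Z : Set G) :=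
    Finset.sum_le_sum_of_subset (Finset.subset_univ E)
  have h3 := sum_unionTotal_le a b
  have key : (lam * E.card) * q ^ 2 ≤ (1584000 * 2 ^ q) * q ^ 2 := by
    calc (lam * E.card) * q ^ 2 = E.card * (lam * q ^ 2) := by ring
      _ ≤ 1584000 * q ^ 2 * 2 ^ q := h1.trans (h2.trans h3)
      _ = (1584000 * 2 ^ q) * q ^ 2 := by ring
  exact Nat.le_of_mul_le_mul_right key hq1

end AverageUnion

end TotalsLaw

end Summit.ValiantsHypothesis.ValiantsHypothesis.Theorems.NewtonUnitEquationsDissociatedUniform
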